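import Mathlib.Analysis.SpecialFunctions.Complex.LogBounds
import Mathlib.Analysis.SpecialFunctions.Complex.Arg
import Summits.RiemannHypothesis.RiemannHypothesis.Theorems.JensenPolynomialsFarGumbelPhase

/-!
# Route `JensenPolynomials`, FAR crux `XiWindowZeroFreeRelFar` (B1-rel far), stub S3 `stub_laplaceFar` — the ONE-POINT
IDENTITY for the far phase at the centre of the saddle disc (input of WANTED item (L5) `wanted_value`)
(RH-FREE; cell rh-jensen, HUMAN RULING D-0040 / D-0074)

LINE 1 (D-0074 framing): RH-FREE algebra of explicit elementary functions (principal logarithms, one exponential); nothing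
here bears on the zeros of `ζ` or is progress toward RH.

Objects (`JensenPolynomialsFarGumbelDefs/Phase`): `Ψ = farPsi M a`, `Λ = farLam υ = πe^{4υ}`, `z̃ = a/υ²`, `ε = 1/υ`,
`w = farW z̃ = (1+z̃)⁻¹`, `ξ₀ = farXi0 w ε`, `f = farF w ε`, the disc centre `u₀ = υ + ξ₀/4`, and
`q₀ = εξ₀/2 + ε²ξ₀²/16`, `G = 9ξ₀/4 + Log(1 + εξ₀/4) − ((9υ+1)/2)·Log(1 + w q₀)` (theory g8's `g(ξ₀)`, S3-BLUEPRINT §1).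

* `norm_farXi0_le` — `‖ξ₀‖ ≤ 3/5` on `‖z̃‖ ≤ 9/25`, `0 < ε ≤ 20/189`.
* `farPsi_center_eq` — for the far mode (`189/20 ≤ υ`, `4πe^{4υ}υ = 2M + 9υ`) and `‖a‖ ≤ (9/25)υ²`:
  `Ψ(u₀) = Log(2π²) + 9υ + log υ + (M − ½)(2 log υ + Log(1+z̃)) + Λ·f(ξ₀) + G`
  (S3-BLUEPRINT §1: `πe^{4u₀} = Λe^{ξ₀}`, `u₀ = υ(1 + εξ₀/4)`, `u₀² + a = υ²(1+z̃)(1 + wq₀)`, and the mode equation in the form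
  `M − ½ = 2Λυ − (9υ+1)/2`; branches: `Re(1+z̃) > 0`, `Re(1 + wq₀) > 0`).
* `norm_farGumbelG_le` — `‖G‖ ≤ 1` (the cancellation `9ξ₀/4 − ((9υ+1)/2)·wq₀ = (9/4)(1−w)ξ₀ − εwξ₀/4 − (9+ε)εwξ₀²/32`).
* `re_farPsi_center_bookkeeping` — for every `X > 0`:
  `Re Ψ(u₀) + ½(log π − log(X/2)) − farMain M υ z̃ = Re G + ½·log(16Λ‖w‖/X)`
  (the `L₀`-constants cancel: `log(2π²) − log(π²/2) = log 4 = ½ log 16`).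

So WANTED (L5) reduces to `|Re Ψ(u) − Re Ψ(u₀)|` small (from (L1)+(L2)) and `½|log(16Λ‖w‖/‖Ψ″(u)‖)| ≤ ½log 3` ((L2) v3).
WHAT THIS IS NOT: nothing about `ξ` or `ζ`. References: theory g8's S3-BLUEPRINT §1/§4; eng-4 g3's S3 WANTED list v3 (HOME
`eng-4/S3/S3-WANTED.lean`, sha16 `d6f8107cd04d985a`); GORZ 2019 [GORZPNAS2019].
-/

noncomputable section
-- D-0017: `Summit.RiemannHypothesis.RiemannHypothesis.…` duplicates the namespace BY DESIGN (single-problem summit).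
set_option linter.dupNamespace false

namespace Summit.RiemannHypothesis.RiemannHypothesis.Theorems.JensenPolynomials.FarGumbel

open Complex
open scoped Real

/-! ## 1. Sizes on the disc `‖z̃‖ ≤ 9/25` -/

/-- `1 + z ≠ 0`, `‖(1+z)⁻¹‖ ≤ 25/16`, `‖Log(1+z)‖ ≤ 27/50` and `(1+z)⁻¹·(1+z) = 1` for `‖z‖ ≤ 9/25`. -/
theorem farW_facts {z : ℂ} (hz : ‖z‖ ≤ (9 / 25 : ℝ)) :
    1 + z ≠ 0 ∧ ‖farW z‖ ≤ 25 / 16 ∧ ‖Complex.log (1 + z)‖ ≤ 27 / 50 ∧ farW z * (1 + z) = 1 := by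
  have hn1 : (16 : ℝ) / 25 ≤ ‖1 + z‖ := by
    have h := norm_sub_le (1 + z) z
    simp only [add_sub_cancel_right, norm_one] at h
    linarith
  have h1z : 1 + z ≠ 0 := by
    intro h; rw [h, norm_zero] at hn1; norm_num at hn1
  refine ⟨h1z, ?_, ?_, ?_⟩
  · rw [farW, norm_inv]
    calc ‖1 + z‖⁻¹ ≤ ((16 : ℝ) / 25)⁻¹ := inv_anti₀ (by norm_num) hn1
      _ = 25 / 16 := by norm_num
  · have := Complex.norm_log_one_add_half_le_self (z := z) (by linarith)
    linarith
  · rw [farW, inv_mul_cancel₀ h1z]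

/-- **`‖ξ₀‖ ≤ 3/5`** on `‖z̃‖ ≤ 9/25`, `0 < ε ≤ 20/189` (`ξ₀ = Log w·(1 + ε(1/4 − w/2))`, `‖Log w‖ = ‖Log(1+z̃)‖ ≤ 27/50`,
`‖1 + ε(1/4 − w/2)‖ ≤ 1 + ε·33/32`; true sup `0.4463·1.05`). -/
theorem norm_farXi0_le {z : ℂ} (hz : ‖z‖ ≤ (9 / 25 : ℝ)) {ε : ℝ} (hε : 0 < ε) (hε' : ε ≤ 20 / 189) :
    ‖farXi0 (farW z) ε‖ ≤ 3 / 5 := by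
  obtain ⟨h1z, hw, hL, _⟩ := farW_facts hz
  have hz1 : ‖z‖ < 1 := lt_of_le_of_lt hz (by norm_num)
  have hslit : 1 + z ∈ Complex.slitPlane := Complex.mem_slitPlane_of_norm_lt_one hz1
  have hLw : Complex.log (farW z) = -Complex.log (1 + z) := by
    rw [farW]; exact Complex.log_inv _ (Complex.slitPlane_arg_ne_pi hslit)
  rw [farXi0, hLw, norm_mul, norm_neg]
  have hfac : ‖1 + (ε : ℂ) * (1 / 4 - farW z / 2)‖ ≤ 1 + ε * (33 / 32) := by
    calc ‖1 + (ε : ℂ) * (1 / 4 - farW z / 2)‖ ≤ ‖(1 : ℂ)‖ + ‖(ε : ℂ) * (1 / 4 - farW z / 2)‖ := norm_add_le _ _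
      _ = 1 + ε * ‖(1 / 4 : ℂ) - farW z / 2‖ := by
          rw [norm_one, norm_mul, Complex.norm_real, Real.norm_of_nonneg hε.le]
      _ ≤ 1 + ε * (33 / 32) := by
          have : ‖(1 / 4 : ℂ) - farW z / 2‖ ≤ 33 / 32 := by
            have h14 : ‖(1 / 4 : ℂ)‖ = 1 / 4 := by norm_num
            have hw2 : ‖farW z / 2‖ ≤ 25 / 16 / 2 := by
              rw [norm_div, Complex.norm_two]; linarith
            calc ‖(1 / 4 : ℂ) - farW z / 2‖ ≤ ‖(1 / 4 : ℂ)‖ + ‖farW z / 2‖ := norm_sub_le _ _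
              _ ≤ 1 / 4 + 25 / 16 / 2 := by rw [h14]; linarith
              _ = 33 / 32 := by norm_num
          have := mul_le_mul_of_nonneg_left this hε.le
          linarith
  calc ‖Complex.log (1 + z)‖ * ‖1 + (ε : ℂ) * (1 / 4 - farW z / 2)‖
      ≤ 27 / 50 * (1 + ε * (33 / 32)) := mul_le_mul hL hfac (norm_nonneg _) (by norm_num)
    _ ≤ 3 / 5 := by nlinarith

/-! ## 2. The one-point identity -/

/-- **The far phase at the disc centre** (S3-BLUEPRINT §1 at the single point `ξ = ξ₀`): for the far mode and
`‖a‖ ≤ (9/25)υ²`, with `z̃ = a/υ²`, `w = farW z̃`, `ξ₀ = farXi0 w (1/υ)`, `u₀ = υ + ξ₀/4`,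
`q₀ = ξ₀/(2υ) + ξ₀²/(16υ²)`:
`Ψ(u₀) = Log(2π²) + 9υ + log υ + (M − ½)(2 log υ + Log(1+z̃)) + Λ·farF w (1/υ) ξ₀ + G`,
`G = 9ξ₀/4 + Log(1 + ξ₀/(4υ)) − ((9υ+1)/2)·Log(1 + w q₀)`. -/
theorem farPsi_center_eq (M : ℕ) {υ : ℝ}
    (hυ : (189 / 20 : ℝ) ≤ υ ∧ 4 * Real.pi * Real.exp (4 * υ) * υ = 2 * (M : ℝ) + 9 * υ)
    {a : ℂ} (ha : ‖a‖ ≤ (9 / 25 : ℝ) * υ ^ 2) :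
    farPsi M a ((υ : ℂ) + farXi0 (farW (a / (υ : ℂ) ^ 2)) (1 / υ) / 4) =
      Complex.log (2 * (π : ℂ) ^ 2) + 9 * (υ : ℂ) + (Real.log υ : ℂ) +
        ((M : ℂ) - 1 / 2) * (2 * (Real.log υ : ℂ) + Complex.log (1 + a / (υ : ℂ) ^ 2)) +
        (farLam υ : ℂ) * farF (farW (a / (υ : ℂ) ^ 2)) (1 / υ) (farXi0 (farW (a / (υ : ℂ) ^ 2)) (1 / υ)) +
        (9 * farXi0 (farW (a / (υ : ℂ) ^ 2)) (1 / υ) / 4 +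
          Complex.log (1 + ((1 / υ : ℝ) : ℂ) * farXi0 (farW (a / (υ : ℂ) ^ 2)) (1 / υ) / 4) -
          (9 * (υ : ℂ) + 1) / 2 * Complex.log (1 + farW (a / (υ : ℂ) ^ 2) *
            (((1 / υ : ℝ) : ℂ) * farXi0 (farW (a / (υ : ℂ) ^ 2)) (1 / υ) / 2 +
              ((1 / υ : ℝ) : ℂ) ^ 2 * farXi0 (farW (a / (υ : ℂ) ^ 2)) (1 / υ) ^ 2 / 16))) := by
  obtain ⟨hυ0, hmode⟩ := hυ
  have hυpos : 0 < υ := by linarith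
  have hυne : (υ : ℂ) ≠ 0 := by exact_mod_cast hυpos.ne'
  set z : ℂ := a / (υ : ℂ) ^ 2 with hzdef
  set w : ℂ := farW z with hwdef
  set ξ₀ : ℂ := farXi0 w (1 / υ) with hξdef
  set e : ℂ := ((1 / υ : ℝ) : ℂ) with hedef
  set q₀ : ℂ := e * ξ₀ / 2 + e ^ 2 * ξ₀ ^ 2 / 16 with hqdef
  -- sizes
  have hz : ‖z‖ ≤ (9 / 25 : ℝ) := by
    rw [hzdef, norm_div, norm_pow, Complex.norm_real, Real.norm_of_nonneg hυpos.le,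
      div_le_iff₀ (by positivity)]
    exact ha
  have hε : (0 : ℝ) < 1 / υ := by positivity
  have hε' : 1 / υ ≤ 20 / 189 := by rw [div_le_div_iff₀ hυpos (by norm_num)]; linarith
  obtain ⟨h1z, hw, _, hw1z⟩ := farW_facts hz
  have hξ : ‖ξ₀‖ ≤ 3 / 5 := norm_farXi0_le hz hε hε'
  have he : e = 1 / (υ : ℂ) := by rw [hedef]; push_cast; ring
  have hυe : (υ : ℂ) * e = 1 := by rw [he]; field_simp
  have he_norm : ‖e‖ = 1 / υ := by rw [hedef, Complex.norm_real, Real.norm_of_nonneg hε.le]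
  have hq : ‖q₀‖ ≤ 1 / 25 := by
    have h1 : ‖e * ξ₀ / 2‖ ≤ 20 / 189 * (3 / 5) / 2 := by
      rw [norm_div, norm_mul, he_norm, Complex.norm_two]
      gcongr
    have h2 : ‖e ^ 2 * ξ₀ ^ 2 / 16‖ ≤ (20 / 189) ^ 2 * (3 / 5) ^ 2 / 16 := by
      rw [norm_div, norm_mul, norm_pow, norm_pow, he_norm]
      have : ‖(16 : ℂ)‖ = 16 := by norm_num
      rw [this]
      gcongr
    calc ‖q₀‖ ≤ ‖e * ξ₀ / 2‖ + ‖e ^ 2 * ξ₀ ^ 2 / 16‖ := norm_add_le _ _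
      _ ≤ 1 / 25 := by linarith
  have hwq : ‖w * q₀‖ ≤ 1 / 16 := by
    rw [norm_mul]
    calc ‖w‖ * ‖q₀‖ ≤ 25 / 16 * (1 / 25) := mul_le_mul hw hq (norm_nonneg _) (by norm_num)
      _ = 1 / 16 := by norm_num
  -- non-vanishing and branch facts
  have hA : 1 + e * ξ₀ / 4 ≠ 0 := by
    intro h
    have h1 : ‖e * ξ₀ / 4‖ = 1 := by
      have e1 : e * ξ₀ / 4 = -1 := by linear_combination h
      rw [e1, norm_neg, norm_one]
    have h4 : ‖(4 : ℂ)‖ = 4 := by norm_num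
    rw [norm_div, norm_mul, he_norm, h4] at h1
    have h2 : 1 / υ * ‖ξ₀‖ ≤ 20 / 189 * (3 / 5) := mul_le_mul hε' hξ (norm_nonneg _) (by norm_num)
    linarith
  have hreB : 0 < (1 + w * q₀).re := by
    rw [show (1 + w * q₀).re = 1 + (w * q₀).re by simp]; linarith [(abs_le.1 (abs_re_le_norm (w * q₀))).1]
  have hB : 1 + w * q₀ ≠ 0 := fun h => by rw [h] at hreB; simp at hreB
  have hre1z : 0 < (1 + z).re := by
    rw [show (1 + z).re = 1 + z.re by simp]; linarith [(abs_le.1 (abs_re_le_norm z)).1]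
  have harg : (1 + z).arg + (1 + w * q₀).arg ∈ Set.Ioc (-π) π := by
    obtain ⟨h1a, h1b⟩ := abs_lt.1 (Complex.abs_arg_lt_pi_div_two_iff.2 (Or.inl hre1z))
    obtain ⟨h2a, h2b⟩ := abs_lt.1 (Complex.abs_arg_lt_pi_div_two_iff.2 (Or.inl hreB))
    constructor <;> linarith
  -- algebra: `u₀ = υ(1 + εξ₀/4)`, `u₀² + a = υ²(1+z̃)(1+wq₀)`
  have hu0 : (υ : ℂ) + ξ₀ / 4 = (υ : ℂ) * (1 + e * ξ₀ / 4) := by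
    linear_combination (-(ξ₀ / 4)) * hυe
  have haz : a = z * (υ : ℂ) ^ 2 := by rw [hzdef]; field_simp
  have hsq : ((υ : ℂ) + ξ₀ / 4) ^ 2 + a = ((υ ^ 2 : ℝ) : ℂ) * ((1 + z) * (1 + w * q₀)) := by
    have e1 : (1 + z) * (1 + w * q₀) = 1 + z + q₀ := by linear_combination q₀ * hw1z
    rw [e1, haz, hqdef]
    push_cast
    linear_combination (-((υ : ℂ) * ξ₀ / 2) - ξ₀ ^ 2 / 16 * (1 + (υ : ℂ) * e)) * hυe
  -- the logarithms
  have hlog_u : Complex.log ((υ : ℂ) + ξ₀ / 4) = (Real.log υ : ℂ) + Complex.log (1 + e * ξ₀ / 4) := by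
    rw [hu0, Complex.log_ofReal_mul hυpos hA]
  have hlog_sq : Complex.log (((υ : ℂ) + ξ₀ / 4) ^ 2 + a) =
      2 * (Real.log υ : ℂ) + Complex.log (1 + z) + Complex.log (1 + w * q₀) := by
    rw [hsq, Complex.log_ofReal_mul (by positivity) (mul_ne_zero h1z hB), Complex.log_mul h1z hB harg,
      Real.log_pow]
    push_cast; ring
  -- the exponential: `πe^{4u₀} = Λe^{ξ₀}`
  have hexp : (π : ℂ) * Complex.exp (4 * ((υ : ℂ) + ξ₀ / 4)) = (farLam υ : ℂ) * Complex.exp ξ₀ := by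
    rw [farLam, show (4 : ℂ) * ((υ : ℂ) + ξ₀ / 4) = ((4 * υ : ℝ) : ℂ) + ξ₀ by push_cast; ring,
      Complex.exp_add]
    push_cast
    ring
  -- the mode equation as `M − ½ = 2Λυ − (9υ+1)/2`
  have hmodeC : ((M : ℂ) - 1 / 2) = 2 * (farLam υ : ℂ) * (υ : ℂ) - (9 * (υ : ℂ) + 1) / 2 := by
    have h' : ((M : ℝ) : ℂ) = (((4 * farLam υ * υ - 9 * υ) / 2 : ℝ) : ℂ) := by
      congr 1; rw [farLam]; linarith
    push_cast at h'
    linear_combination h'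
  -- `farF` at `ε = 1/υ`: the prefactor `2/ε = 2υ`
  have hF : farF w (1 / υ) ξ₀ = 2 * (υ : ℂ) * Complex.log (1 + w * q₀) - Complex.exp ξ₀ := by
    rw [farF, hqdef, hedef]
    have h2e : (2 / (1 / υ) : ℝ) = 2 * υ := by field_simp
    rw [h2e]; push_cast; ring
  -- assemble
  rw [farPsi, hlog_u, hlog_sq, hexp, hF]
  linear_combination Complex.log (1 + w * q₀) * hmodeC

/-! ## 3. The size of `G` -/

/-- **`‖G‖ ≤ 1`** for `‖z̃‖ ≤ 9/25`, `189/20 ≤ υ` (`ε = 1/υ`), where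
`G = 9ξ₀/4 + Log(1 + εξ₀/4) − ((9υ+1)/2)·Log(1 + w(εξ₀/2 + ε²ξ₀²/16))`: after the cancellation
`9ξ₀/4 − ((9υ+1)/2)·w q₀ = (9/4)(1−w)ξ₀ − εwξ₀/4 − (9+ε)εwξ₀²/32` (`1 − w = z̃w`), termwise
`(9/4)(9/16)(3/5) + 0.03 + 0.02 + 0.03 + ((9υ+1)/2)·‖wq₀‖²/(2(1−‖wq₀‖)) ≤ 1` (true value `≤ 0.565`). -/
theorem norm_farGumbelG_le {z : ℂ} (hz : ‖z‖ ≤ (9 / 25 : ℝ)) {υ : ℝ} (hυ : (189 / 20 : ℝ) ≤ υ) :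
    ‖9 * farXi0 (farW z) (1 / υ) / 4 + Complex.log (1 + ((1 / υ : ℝ) : ℂ) * farXi0 (farW z) (1 / υ) / 4) -
        (9 * (υ : ℂ) + 1) / 2 * Complex.log (1 + farW z *
          (((1 / υ : ℝ) : ℂ) * farXi0 (farW z) (1 / υ) / 2 +
            ((1 / υ : ℝ) : ℂ) ^ 2 * farXi0 (farW z) (1 / υ) ^ 2 / 16))‖ ≤ 1 := by
  have hυpos : 0 < υ := by linarith
  have hε : (0 : ℝ) < 1 / υ := by positivity
  have hε' : 1 / υ ≤ 20 / 189 := by rw [div_le_div_iff₀ hυpos (by norm_num)]; linarith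
  obtain ⟨h1z, hw, _, hw1z⟩ := farW_facts hz
  set w : ℂ := farW z with hwdef
  set ξ₀ : ℂ := farXi0 w (1 / υ) with hξdef
  set e : ℂ := ((1 / υ : ℝ) : ℂ) with hedef
  set ε : ℝ := 1 / υ with hεdef
  set q₀ : ℂ := e * ξ₀ / 2 + e ^ 2 * ξ₀ ^ 2 / 16 with hqdef
  have hξ : ‖ξ₀‖ ≤ 3 / 5 := norm_farXi0_le hz hε hε'
  have hυne : (υ : ℂ) ≠ 0 := by exact_mod_cast hυpos.ne'
  have hυe : (υ : ℂ) * e = 1 := by rw [hedef, hεdef]; push_cast; field_simp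
  have he_norm : ‖e‖ = ε := by rw [hedef, Complex.norm_real, Real.norm_of_nonneg hε.le]
  have hξ0 : 0 ≤ ‖ξ₀‖ := norm_nonneg _
  -- `‖q₀‖ ≤ (121/400)ε`, `‖wq₀‖ ≤ (121/256)ε ≤ 1/19`
  have hq : ‖q₀‖ ≤ 121 / 400 * ε := by
    have h1 : ‖e * ξ₀ / 2‖ ≤ ε * (3 / 5) / 2 := by
      rw [norm_div, norm_mul, he_norm, Complex.norm_two]
      gcongr
    have h2 : ‖e ^ 2 * ξ₀ ^ 2 / 16‖ ≤ ε * (20 / 189) * (3 / 5) ^ 2 / 16 := by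
      rw [norm_div, norm_mul, norm_pow, norm_pow, he_norm]
      have : ‖(16 : ℂ)‖ = 16 := by norm_num
      rw [this, pow_two]
      have := mul_le_mul (le_refl ε) hε' hε.le hε.le
      have h3 : ‖ξ₀‖ ^ 2 ≤ (3 / 5) ^ 2 := pow_le_pow_left₀ hξ0 hξ 2
      have h4 : ε * ε * ‖ξ₀‖ ^ 2 ≤ ε * (20 / 189) * (3 / 5) ^ 2 :=
        mul_le_mul this h3 (by positivity) (by positivity)
      linarith
    calc ‖q₀‖ ≤ ‖e * ξ₀ / 2‖ + ‖e ^ 2 * ξ₀ ^ 2 / 16‖ := norm_add_le _ _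
      _ ≤ 121 / 400 * ε := by nlinarith
  have hwq : ‖w * q₀‖ ≤ 121 / 256 * ε := by
    rw [norm_mul]
    calc ‖w‖ * ‖q₀‖ ≤ 25 / 16 * (121 / 400 * ε) := mul_le_mul hw hq (norm_nonneg _) (by norm_num)
      _ = 121 / 256 * ε := by ring
  have hwq' : ‖w * q₀‖ ≤ 1 / 19 := by nlinarith
  have hwq1 : ‖w * q₀‖ < 1 := by linarith
  -- the cancellation
  set R : ℂ := Complex.log (1 + w * q₀) - w * q₀ with hRdef
  have hR : ‖R‖ ≤ (121 / 256 * ε) ^ 2 * (19 / 18) / 2 := by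
    have h0 := Complex.norm_log_one_add_sub_self_le hwq1
    have h1 : (1 - ‖w * q₀‖)⁻¹ ≤ 19 / 18 := by
      rw [inv_le_comm₀ (by linarith) (by norm_num)]; linarith
    have h2 : ‖w * q₀‖ ^ 2 ≤ (121 / 256 * ε) ^ 2 := pow_le_pow_left₀ (norm_nonneg _) hwq 2
    calc ‖R‖ ≤ ‖w * q₀‖ ^ 2 * (1 - ‖w * q₀‖)⁻¹ / 2 := h0
      _ ≤ (121 / 256 * ε) ^ 2 * (19 / 18) / 2 := by gcongr
  have hGeq : 9 * ξ₀ / 4 + Complex.log (1 + e * ξ₀ / 4) - (9 * (υ : ℂ) + 1) / 2 * Complex.log (1 + w * q₀) =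
      9 / 4 * (z * w) * ξ₀ - e * w * ξ₀ / 4 - (9 + e) * e * w * ξ₀ ^ 2 / 32 + Complex.log (1 + e * ξ₀ / 4) -
        (9 * (υ : ℂ) + 1) / 2 * R := by
    rw [hRdef, hqdef]
    linear_combination (-(9 / 4 * ξ₀)) * hw1z +
      (-(9 * w * ξ₀ / 4) - 9 * e * w * ξ₀ ^ 2 / 32) * hυe
  -- termwise bounds
  have hzw : ‖z * w‖ ≤ 9 / 16 := by
    rw [norm_mul]
    calc ‖z‖ * ‖w‖ ≤ 9 / 25 * (25 / 16) := mul_le_mul hz hw (norm_nonneg _) (by norm_num)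
      _ = 9 / 16 := by norm_num
  have hT1 : ‖9 / 4 * (z * w) * ξ₀‖ ≤ 9 / 4 * (9 / 16) * (3 / 5) := by
    rw [norm_mul, norm_mul]
    have : ‖(9 / 4 : ℂ)‖ = 9 / 4 := by norm_num
    rw [this]
    gcongr
  have hT2 : ‖e * w * ξ₀ / 4‖ ≤ 20 / 189 * (25 / 16) * (3 / 5) / 4 := by
    rw [norm_div, norm_mul, norm_mul, he_norm]
    have : ‖(4 : ℂ)‖ = 4 := by norm_num
    rw [this]
    gcongr
  have hT3 : ‖(9 + e) * e * w * ξ₀ ^ 2 / 32‖ ≤ (9 + 20 / 189) * (20 / 189) * (25 / 16) * (3 / 5) ^ 2 / 32 := by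
    rw [norm_div, norm_mul, norm_mul, norm_mul, norm_pow, he_norm]
    have h32 : ‖(32 : ℂ)‖ = 32 := by norm_num
    have h9 : ‖(9 : ℂ) + e‖ ≤ 9 + 20 / 189 := by
      calc ‖(9 : ℂ) + e‖ ≤ ‖(9 : ℂ)‖ + ‖e‖ := norm_add_le _ _
        _ ≤ 9 + 20 / 189 := by rw [he_norm, Complex.norm_ofNat]; linarith
    rw [h32]
    gcongr
  have hT4 : ‖Complex.log (1 + e * ξ₀ / 4)‖ ≤ 3 / 2 * (20 / 189 * (3 / 5) / 4) := by
    have h1 : ‖e * ξ₀ / 4‖ ≤ 20 / 189 * (3 / 5) / 4 := by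
      rw [norm_div, norm_mul, he_norm]
      have : ‖(4 : ℂ)‖ = 4 := by norm_num
      rw [this]
      gcongr
    have := Complex.norm_log_one_add_half_le_self (z := e * ξ₀ / 4) (by linarith)
    linarith
  have hT5 : ‖(9 * (υ : ℂ) + 1) / 2 * R‖ ≤ (9 + 20 / 189) * (121 / 256) ^ 2 * (19 / 18) / 4 * (20 / 189) := by
    rw [norm_mul]
    have h9 : ‖(9 * (υ : ℂ) + 1) / 2‖ = (9 * υ + 1) / 2 := by
      have : (9 * (υ : ℂ) + 1) / 2 = (((9 * υ + 1) / 2 : ℝ) : ℂ) := by push_cast; ring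
      rw [this, Complex.norm_real, Real.norm_of_nonneg (by positivity)]
    rw [h9]
    have hυε : υ * ε = 1 := by rw [hεdef]; field_simp
    calc (9 * υ + 1) / 2 * ‖R‖ ≤ (9 * υ + 1) / 2 * ((121 / 256 * ε) ^ 2 * (19 / 18) / 2) :=
          mul_le_mul_of_nonneg_left hR (by positivity)
      _ = (9 + ε) * (121 / 256) ^ 2 * (19 / 18) / 4 * ε := by
          have : (9 * υ + 1) * ε = 9 + ε := by linear_combination 9 * hυε
          linear_combination ((121 / 256 : ℝ) ^ 2 * (19 / 18) / 4 * ε) * this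
      _ ≤ (9 + 20 / 189) * (121 / 256) ^ 2 * (19 / 18) / 4 * (20 / 189) := by
          have h1 : 9 + ε ≤ 9 + 20 / 189 := by linarith
          have h2 : (0 : ℝ) ≤ 9 + ε := by linarith
          have := mul_le_mul h1 hε' hε.le (by norm_num)
          nlinarith
  rw [hGeq]
  calc ‖9 / 4 * (z * w) * ξ₀ - e * w * ξ₀ / 4 - (9 + e) * e * w * ξ₀ ^ 2 / 32 + Complex.log (1 + e * ξ₀ / 4) -
          (9 * (υ : ℂ) + 1) / 2 * R‖
      ≤ ‖9 / 4 * (z * w) * ξ₀‖ + ‖e * w * ξ₀ / 4‖ + ‖(9 + e) * e * w * ξ₀ ^ 2 / 32‖ +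
          ‖Complex.log (1 + e * ξ₀ / 4)‖ + ‖(9 * (υ : ℂ) + 1) / 2 * R‖ := by
        have e1 := norm_sub_le (9 / 4 * (z * w) * ξ₀ - e * w * ξ₀ / 4 - (9 + e) * e * w * ξ₀ ^ 2 / 32 +
          Complex.log (1 + e * ξ₀ / 4)) ((9 * (υ : ℂ) + 1) / 2 * R)
        have e2 := norm_add_le (9 / 4 * (z * w) * ξ₀ - e * w * ξ₀ / 4 - (9 + e) * e * w * ξ₀ ^ 2 / 32)
          (Complex.log (1 + e * ξ₀ / 4))
        have e3 := norm_sub_le (9 / 4 * (z * w) * ξ₀ - e * w * ξ₀ / 4) ((9 + e) * e * w * ξ₀ ^ 2 / 32)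
        have e4 := norm_sub_le (9 / 4 * (z * w) * ξ₀) (e * w * ξ₀ / 4)
        linarith
    _ ≤ 1 := by
        have := hT1; have := hT2; have := hT3; have := hT4; have := hT5
        norm_num at *
        linarith

/-! ## 4. Bookkeeping of the `O(1)` constants -/

/-- **The `L₀`-constants cancel** (S3-BLUEPRINT §4 ledger): for every `X > 0`, with `z̃ = a/υ²`, `w = farW z̃`,
`ξ₀ = farXi0 w (1/υ)`, `u₀ = υ + ξ₀/4` and `G` as in `farPsi_center_eq`,
`Re Ψ(u₀) + ½(log π − log(X/2)) − farMain M υ z̃ = Re G + ½·log(16·Λ·‖w‖/X)`. -/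
theorem re_farPsi_center_bookkeeping (M : ℕ) {υ : ℝ}
    (hυ : (189 / 20 : ℝ) ≤ υ ∧ 4 * Real.pi * Real.exp (4 * υ) * υ = 2 * (M : ℝ) + 9 * υ)
    {a : ℂ} (ha : ‖a‖ ≤ (9 / 25 : ℝ) * υ ^ 2) {X : ℝ} (hX : 0 < X) :
    (farPsi M a ((υ : ℂ) + farXi0 (farW (a / (υ : ℂ) ^ 2)) (1 / υ) / 4)).re +
        1 / 2 * (Real.log π - Real.log (X / 2)) - farMain M υ (a / (υ : ℂ) ^ 2) =
      (9 * farXi0 (farW (a / (υ : ℂ) ^ 2)) (1 / υ) / 4 +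
          Complex.log (1 + ((1 / υ : ℝ) : ℂ) * farXi0 (farW (a / (υ : ℂ) ^ 2)) (1 / υ) / 4) -
          (9 * (υ : ℂ) + 1) / 2 * Complex.log (1 + farW (a / (υ : ℂ) ^ 2) *
            (((1 / υ : ℝ) : ℂ) * farXi0 (farW (a / (υ : ℂ) ^ 2)) (1 / υ) / 2 +
              ((1 / υ : ℝ) : ℂ) ^ 2 * farXi0 (farW (a / (υ : ℂ) ^ 2)) (1 / υ) ^ 2 / 16))).re +
        1 / 2 * Real.log (16 * farLam υ * ‖farW (a / (υ : ℂ) ^ 2)‖ / X) := by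
  have hυpos : 0 < υ := by linarith [hυ.1]
  have hΛ : 0 < farLam υ := by rw [farLam]; positivity
  have hz : ‖a / (υ : ℂ) ^ 2‖ ≤ (9 / 25 : ℝ) := by
    rw [norm_div, norm_pow, Complex.norm_real, Real.norm_of_nonneg hυpos.le, div_le_iff₀ (by positivity)]
    exact ha
  obtain ⟨h1z, _, _, _⟩ := farW_facts hz
  have hw0 : 0 < ‖farW (a / (υ : ℂ) ^ 2)‖ := by
    rw [farW, norm_inv, inv_pos]; exact norm_pos_iff.2 h1z
  rw [farPsi_center_eq M hυ ha]
  set G : ℂ := 9 * farXi0 (farW (a / (υ : ℂ) ^ 2)) (1 / υ) / 4 +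
      Complex.log (1 + ((1 / υ : ℝ) : ℂ) * farXi0 (farW (a / (υ : ℂ) ^ 2)) (1 / υ) / 4) -
      (9 * (υ : ℂ) + 1) / 2 * Complex.log (1 + farW (a / (υ : ℂ) ^ 2) *
        (((1 / υ : ℝ) : ℂ) * farXi0 (farW (a / (υ : ℂ) ^ 2)) (1 / υ) / 2 +
          ((1 / υ : ℝ) : ℂ) ^ 2 * farXi0 (farW (a / (υ : ℂ) ^ 2)) (1 / υ) ^ 2 / 16)) with hGdef
  set F : ℂ := farF (farW (a / (υ : ℂ) ^ 2)) (1 / υ) (farXi0 (farW (a / (υ : ℂ) ^ 2)) (1 / υ)) with hFdef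
  set w : ℂ := farW (a / (υ : ℂ) ^ 2) with hwdef
  -- real parts of the explicit terms
  have h2pi : Complex.log (2 * (π : ℂ) ^ 2) = ((Real.log (2 * π ^ 2) : ℝ) : ℂ) := by
    rw [Complex.ofReal_log (by positivity)]; push_cast; ring_nf
  have hre : (Complex.log (2 * (π : ℂ) ^ 2) + 9 * (υ : ℂ) + (Real.log υ : ℂ) +
        ((M : ℂ) - 1 / 2) * (2 * (Real.log υ : ℂ) + Complex.log (1 + a / (υ : ℂ) ^ 2)) +
        (farLam υ : ℂ) * F + G).re =
      Real.log (2 * π ^ 2) + 9 * υ + Real.log υ +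
        ((M : ℝ) - 1 / 2) * (2 * Real.log υ + Real.log ‖1 + a / (υ : ℂ) ^ 2‖) + farLam υ * F.re + G.re := by
    rw [h2pi]
    have e1 : ((M : ℂ) - 1 / 2) = (((M : ℝ) - 1 / 2 : ℝ) : ℂ) := by push_cast; ring
    rw [e1]
    simp only [Complex.add_re, Complex.ofReal_re, Complex.mul_re, Complex.ofReal_im,
      Complex.log_re, zero_mul, sub_zero]
    norm_num
  rw [hre, farMain, farL0]
  -- the real logarithms
  have hL1 : Real.log (Real.pi ^ 2 / 2 * Real.exp (9 * υ) * υ ^ (2 * M)) =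
      Real.log (Real.pi ^ 2 / 2) + 9 * υ + 2 * M * Real.log υ := by
    rw [Real.log_mul (by positivity) (by positivity), Real.log_mul (by positivity) (by positivity),
      Real.log_exp, Real.log_pow]
    push_cast; ring
  have hL2 : Real.log (2 * π ^ 2) - Real.log (Real.pi ^ 2 / 2) = 2 * Real.log 2 := by
    rw [← Real.log_div (by positivity) (by positivity)]
    rw [show (2 * π ^ 2 / (π ^ 2 / 2) : ℝ) = 2 ^ 2 by field_simp, Real.log_pow]
    norm_num
  have hL3 : Real.log (16 * farLam υ * ‖w‖ / X) =
      4 * Real.log 2 + Real.log (farLam υ) + Real.log ‖w‖ - Real.log X := by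
    rw [Real.log_div (by positivity) hX.ne', Real.log_mul (by positivity) hw0.ne',
      Real.log_mul (by norm_num) hΛ.ne', show (16 : ℝ) = 2 ^ 4 by norm_num, Real.log_pow]
    push_cast; ring
  have hL4 : Real.log (2 * π / farLam υ) = Real.log 2 + Real.log π - Real.log (farLam υ) := by
    rw [Real.log_div (by positivity) hΛ.ne', Real.log_mul (by norm_num) Real.pi_pos.ne']
  have hL5 : Real.log (X / 2) = Real.log X - Real.log 2 := by
    rw [Real.log_div hX.ne' (by norm_num)]
  rw [hL1, hL3, hL4, hL5]
  linear_combination hL2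

end Summit.RiemannHypothesis.RiemannHypothesis.Theorems.JensenPolynomials.FarGumbel

end
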